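import Summits.HodgeConjecture.CorCM.MumfordTateRankTypeIVThreefoldPairs
import HarnessLib

/-!
# Two simple type-IV(2,1) abelian threefolds with ISOMORPHIC imaginary quadratic fields: `dim Lie Hg(H¹(T × T')) ≤ 17`, `10 ≤ t(T × T') ≤ 18 < 19`

COR-CM (cell `pub-hodgecm2`, seat `b27` gen 48/49, count-neutral Mumford–Tate-rank ladder; theorems only, no definition, no named fact;
UNCONDITIONAL — nothing here uses or asserts HC_CM).  The threefold cells of `CorCM/MumfordTateRankTypeIVThreefoldPairs` (split off for the size
limit): two simple abelian threefolds `T`, `T'` with `dim_ℚ End⁰ = 2` are of Ribet type `(2,1)` (Shimura; `ribetTypeOne_data_of_isSimple_threefold`),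
and a ring homomorphism `End⁰T' → End⁰T` matches the data (`exists_matched_data_of_ringHom_threefolds`), so the general strict inequality
`dim Lie Hg(H¹(A × A')) < 2g²` of that file gives:

* **`finrank_hodgeLie_hodge_one_prod_typeIV_threefolds_le`** — `dim Lie Hg(H¹(T × T')) ≤ 17` (matched roots);
* **`mtRank_hodge_one_le_eighteen_of_isIsogenous_prod_typeIV_threefolds_of_nonempty_ringHom`** — `t(X) ≤ 18` for `X ∼ T × T'` with
  `End⁰T' →+* End⁰T`, versus `t(T) + t(T') − 1 = 19`: `Hg(T × T') ≠ Hg(T) × Hg(T')` (the Weil classes in `H⁶` of the diagonal field action);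
* **`mtRank_hodge_one_mem_Icc_of_isIsogenous_prod_typeIV_threefolds_of_nonempty_ringHom`** — `10 ≤ t(X) ≤ 18` (`≥ t(T') = 10` by `Θ`-rigidity,
  `CorCM/MumfordTateRankRigidMonotone`).

## References
* [MoonenZarhin1999LowDim] B. Moonen, Yu. G. Zarhin, Math. Ann. 315 (1999), Thm. 0.1 (4)(a), §2 (2.3), §3 (3.1), Prop. (3.8)
  [corpus: paper:arxiv-math_9901113 pp. 1–2, 5–7]. [cite: MoonenZarhin1999LowDim, Thm. 0.1 (4) and §3 (3.1)]
* [Deligne1982HodgeCycles] P. Deligne, LNM 900 (1982), §4 Prop. 4.4 (Weil classes). [cite: Deligne1982HodgeCycles, §4 Prop. 4.4]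
* [Ribet1983] K. A. Ribet, Amer. J. Math. 105 (1983), Thm. 3 (`Hg = U` for type `(g−1,1)`). [cite: Ribet1983, Thm. 3]
-/

noncomputable section

open scoped TensorProduct
open CategoryTheory CategoryTheory.Limits Module NumberField

namespace Summit.HodgeConjecture.CorCM

open Literature.AlgebraicGeometry.Motives
open Literature.AlgebraicGeometry.Motives.AbelianVariety
open Literature.AlgebraicGeometry.Motives.HodgeStructure
open Literature.AlgebraicGeometry.HodgeTheory
open Literature.AlgebraicGeometry.ComplexMultiplication

variable [HodgeTensorFacts.{0, 0}] {X : AbelianVariety ℂ} {n : ℕ}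

/-! ## §3 Two simple type-IV(2,1) threefolds: `dim Lie Hg(H¹(T × T')) ≤ 17`, `10 ≤ t(T × T') ≤ 18` -/

/-- **`dim Lie Hg(H¹(T × T')) ≤ 17 < 9 + 9` for two simple type-IV(2,1) threefolds with the same field and matched roots** (`φ ∘ φ = −D` on `T`,
`φ' ∘ φ' = −D` on `T'`, `dim_ℚ End⁰ = 2`, multiplicities of `i√D` adding up to `3`): §2 with the Ribet data of a simple threefold (Shimura).
[cite: MoonenZarhin1999LowDim, Thm. 0.1 (4) and §3 (3.1)] [cite: Deligne1982HodgeCycles, §4 Prop. 4.4] -/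
theorem finrank_hodgeLie_hodge_one_prod_typeIV_threefolds_le {T T' : AbelianVariety ℂ} {m : ℕ} (hP : IsSmoothProjective m (T.prod T').X)
    (hTs : T.IsSimple) (hT3 : T.dim = 3) (hTE : Module.finrank ℚ T.endAlgebra = 2) (hT's : T'.IsSimple) (hT'3 : T'.dim = 3)
    (hT'E : Module.finrank ℚ T'.endAlgebra = 2) (φ : T ⟶ T) (φ' : T' ⟶ T') {D : ℕ} (hD : 0 < D) (hφ : φ ≫ φ = -(D • 𝟙 T))
    (hφ' : φ' ≫ φ' = -(D • 𝟙 T'))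
    (hmult : eigenMultiplicity T φ (Complex.I * (Real.sqrt D : ℂ)) + eigenMultiplicity T' φ' (Complex.I * (Real.sqrt D : ℂ)) = 3) :
    haveI := BettiUniverse.finite hP 1
    Module.finrank ℚ (BettiUniverse.hodge exists_isReal_hodgeModel_holds hP 1).hodgeLie ≤ 17 := by
  obtain ⟨hF, hnR, h1⟩ := ribetTypeOne_data_of_isSimple_threefold hTs hT3 hTE φ hD hφ
  obtain ⟨hF', hnR', h1'⟩ := ribetTypeOne_data_of_isSimple_threefold hT's hT'3 hT'E φ' hD hφ'
  have h := finrank_hodgeLie_hodge_one_prod_ribetTypeOne_lt hP hF hnR φ hD hφ hTE h1 hF' hnR' φ' hφ' hT'E h1' (by omega) (by omega)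
    (by rw [hT3]; exact hmult)
  rw [hT3] at h
  omega

/-- **`t(X) ≤ 18` for `X ∼ T × T'`, `T`, `T'` simple abelian threefolds with `dim_ℚ End⁰ = 2` and a ring hom `End⁰T' → End⁰T`** (the two imaginary
quadratic fields are isomorphic) — versus `t(T) + t(T') − 1 = 19`: `Hg(T × T') ≠ Hg(T) × Hg(T')`, the Weil classes in `H⁶(T × T', ℚ)` of the
diagonal field action (signature `(3,3)` after matching the roots, `exists_matched_data_of_ringHom_threefolds`) being exceptional.
[cite: MoonenZarhin1999LowDim, Thm. 0.1 (4) and §3 (3.1)] [cite: Deligne1982HodgeCycles, §4 Prop. 4.4] -/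
theorem mtRank_hodge_one_le_eighteen_of_isIsogenous_prod_typeIV_threefolds_of_nonempty_ringHom (hX : IsSmoothProjective n X.X)
    {T T' : AbelianVariety ℂ} (hTs : T.IsSimple) (hT3 : T.dim = 3) (hTE : Module.finrank ℚ T.endAlgebra = 2) (hT's : T'.IsSimple)
    (hT'3 : T'.dim = 3) (hT'E : Module.finrank ℚ T'.endAlgebra = 2) (hfor : Nonempty (T'.endAlgebra →+* T.endAlgebra))
    (hXP : IsIsogenous X (T.prod T')) :
    haveI := BettiUniverse.finite hX 1
    (BettiUniverse.hodge exists_isReal_hodgeModel_holds hX 1).mtRank ≤ 18 := by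
  haveI := BettiUniverse.finite hX 1
  have hP : IsSmoothProjective (T.prod T').dim (T.prod T').X := AbelianVariety.isSmoothProjective_holds
  haveI := BettiUniverse.finite hP 1
  have h0 : 0 < X.dim := by
    obtain ⟨g, hg⟩ := hXP
    rw [dim_eq_of_isIsogeny hg, dim_prod]; omega
  obtain ⟨f⟩ := hfor
  obtain ⟨φ, φ', D, hD, hφ, hφ', hmult⟩ := exists_matched_data_of_ringHom_threefolds hTs hT3 hT's hT'3 hT'E f
  have h17 := finrank_hodgeLie_hodge_one_prod_typeIV_threefolds_le hP hTs hT3 hTE hT's hT'3 hT'E φ φ' hD hφ hφ' hmult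
  have hiso := finrank_hodgeLie_hodge_one_eq_of_isIsogenous hX hP hXP
  rw [mtRank_hodge_one_eq_finrank_hodgeLie_add_one hX h0, hiso]
  omega

/-- **`10 ≤ t(X) ≤ 18` for `X ∼ T × T'` as above** (`≥ 10 = t(T')`: `T'` is `Θ`-rigid, `CorCM/MumfordTateRankRigidMonotone`), strictly below
`t(T) + t(T') − 1 = 19`. [cite: MoonenZarhin1999LowDim, Thm. 0.1 (4) and §3 (3.1)] -/
theorem mtRank_hodge_one_mem_Icc_of_isIsogenous_prod_typeIV_threefolds_of_nonempty_ringHom (hX : IsSmoothProjective n X.X)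
    {T T' : AbelianVariety ℂ} (hTs : T.IsSimple) (hT3 : T.dim = 3) (hTE : Module.finrank ℚ T.endAlgebra = 2) (hT's : T'.IsSimple)
    (hT'3 : T'.dim = 3) (hT'E : Module.finrank ℚ T'.endAlgebra = 2) (hfor : Nonempty (T'.endAlgebra →+* T.endAlgebra))
    (hXP : IsIsogenous X (T.prod T')) :
    haveI := BettiUniverse.finite hX 1
    (BettiUniverse.hodge exists_isReal_hodgeModel_holds hX 1).mtRank ∈ Set.Icc 10 18 := by
  refine ⟨?_, mtRank_hodge_one_le_eighteen_of_isIsogenous_prod_typeIV_threefolds_of_nonempty_ringHom hX hTs hT3 hTE hT's hT'3 hT'E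
    hfor hXP⟩
  exact ten_le_mtRank_hodge_one_of_isIsogenous_prod_isSimple_threefold_of_finrank_eq_two hX hT's hT'3 hT'E hXP

end Summit.HodgeConjecture.CorCM

end
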